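import Literature.MathematicalPhysics.QuantumLattice.FermionicTreeExpansionDecay
import Literature.Analysis.Matrix.DetUnitRowsMinor
import HarnessLib

/-!
# The `n!`-free tree bound for propagators with a DETERMINANT BOUND (no Gram form)

Topic `Literature/MathematicalPhysics/QuantumLattice`; a twin of `FermionicTreeExpansionBounds.lean` /
`FermionicTreeExpansionTrees.lean`. There the Brydges–Battle–Federbush tree expansion of the truncated
fermionic expectation `𝓔ᵀ(W) = ursellOf (moment c G) W` (`FermionicTreeExpansion.lean`) is bounded for
a propagator in GRAM FORM `G f f' = ⟪A f, B f'⟫`, the interpolated determinant left after the tree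
lines being controlled by the Gram–Hadamard inequality. The free propagator of lattice fermions at
positive temperature is NOT of this form with temperature-independent constants (the chronological
step `1_{s ≥ t}` has no good Gram representation, de Siqueira Pedra–Salmhofer 2008, Lemma 2.2); what it
does have is a DETERMINANT BOUND in the sense of Salmhofer–Wieczerkowski / Pedra–Salmhofer (loc. cit.
Thm 1.3, Thm 2.4): every square minor, with the entries multiplied by Gram weights `⟨w_a, w_b⟩` of unit
vectors, has `|det| ≤ δ^{size}` (`PropMatrixWeightedMinorBound.norm_det_weighted_propMatrix_minor_le`:
`δ = 2` for `propMatrix`). This file runs the same tree-expansion bound under that hypothesis, in the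
closed form consumed by the positional sums (`FermionicTreeExpansionDecay.lean`):

* `norm_eval_aeval_assignSum_le_of_detBound` — along the line extractions of a script,
  `‖(assignSum L I jm)(σ_s(t))‖ ≤ δ^{|F_W|} ∏_{ℓ ∈ L} (2 n² M_ℓ)` for `t ∈ [0,1]^ι`, where `n` bounds the
  number of field pairs per cluster and `|G f f'| ≤ M_{{c f, c f'}}` is a cluster-type line bound: each
  line costs its propagator bound times the number `≤ 2n²` of field lines of its type
  (`card_filter_pairType_le`), and the final interpolated determinant with unit rows is reduced to a
  weighted minor (`Matrix.norm_det_le_of_unit_rows_of_minor_bound`) and bounded by `δ^{rows} ≤ δ^{|F_W|}`;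
* `norm_scriptTerm_le_of_detBound` — `‖scriptTerm s‖ ≤ δ^{|F_W|} ∏_{ℓ ∈ lines s} (2n² M_ℓ) · ∫ w_s`;
* **`norm_ursellOf_moment_le_sum_lineSets_of_detBound`** — the tree form
  `‖𝓔ᵀ(W)‖ ≤ Σ_{anchored cluster trees T on W} δ^{|F_W|} ∏_{ℓ ∈ T} (2 n² M_ℓ)`
  (the interpolation weights of the scripts traversing the same tree add up to one,
  `Script.sum_cubeIntegral_weight_eq_one`) — Benfatto–Giuliani–Mastropietro 2006, (2.66)/(2.77) with the
  determinant bound (2.80) in place of Gram–Hadamard; Mastropietro 2008, (2.118)–(2.121).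

Everything is PROVED; no definition and no named fact.

## Mathlib / tree search
Tree: `assignSum`, `tmpl`, `scriptTerm`, `treeSum`, `ursellOf_moment_eq_treeSum`, `enum`, `fieldsOf`,
`c_enum_mem` (`FermionicTreeExpansion`); `eval_map_algebraMap`, `decPt_eq_map`, `weight_eq_map`,
`eval_weight_nonneg`, `norm_cubeIntegral_map_mul_le` (`FermionicTreeExpansionBounds`);
`card_filter_pairType_le` (`FermionicTreeExpansionDecay`); `Script.exists_unit_gram`
(`BattleFederbushGram`), `Script.nodup_lines`, `Script.sum_cubeIntegral_weight_eq_one`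
(`BattleFederbushWeights`), `mem_lineSets`, `Script.image_y_eq_of_lines_eq` (`BattleFederbushTrees`);
`Matrix.norm_det_le_of_unit_rows_of_minor_bound` (`Literature.Analysis.Matrix.DetUnitRowsMinor`).
Mathlib: `List.prod_toFinset`, `Finset.sum_ite`, `Fintype.sum_prod_type'`.

## References
* G. Benfatto, A. Giuliani, V. Mastropietro, Ann. Henri Poincaré 7 (2006) 809–898, (2.66), (2.77), (2.80).
  [cite: BenfattoGiulianiMastropietro2006, (2.66) (2.77) (2.80)]
* V. Mastropietro, *Non-Perturbative Renormalization* (2008), §2.9 (2.118)–(2.121). [cite: Mastropietro2008, §2.9]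
* W. de Siqueira Pedra, M. Salmhofer, Comm. Math. Phys. 282 (2008) 797–818, Thm 1.3. [cite: PedraSalmhofer2008, Thm 1.3]
-/

noncomputable section

open MvPolynomial Finsupp Matrix Finset Literature.RingTheory.MvPolynomial
open Literature.Probability.LatticeModels Literature.Probability.LatticeModels.BattleFederbush
open Literature.MeasureTheory.Integral Literature.Analysis.InnerProduct
open scoped InnerProductSpace

namespace Literature.MathematicalPhysics.QuantumLattice

namespace FermionicTree

variable {𝕜 : Type*} [RCLike 𝕜]
variable {ι : Type*} [Fintype ι] [DecidableEq ι] {F : Type*} [Fintype F] [LinearOrder F]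
variable (c : F → ι) (G : Matrix F F 𝕜)

/-! ### Counting field lines through an enumeration -/

omit [Fintype ι] in
/-- The per-cluster bound on the number of field pairs passes to any injective enumeration.
[folklore] -/
theorem card_filter_comp_le_of_injective {r : ℕ} {e : Fin r → F} (he : Function.Injective e)
    {n₀ : ℕ} (hn : ∀ x : ι, (univ.filter fun f : F => c f = x).card ≤ n₀) (x : ι) :
    (univ.filter fun a : Fin r => c (e a) = x).card ≤ n₀ := by
  refine le_trans ?_ (hn x)
  rw [← Finset.card_image_of_injective (univ.filter fun a : Fin r => c (e a) = x) he]
  refine Finset.card_le_card fun f hf => ?_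
  obtain ⟨a, ha, rfl⟩ := Finset.mem_image.mp hf
  exact mem_filter.mpr ⟨mem_univ _, (mem_filter.mp ha).2⟩

omit [Fintype ι] [Fintype F] [LinearOrder F] in
/-- Summing a constant over the field lines of a given type with an extra restriction costs at most
`2n²` copies. [folklore] -/
theorem sum_sum_ite_le_card_mul {r : ℕ} (e : Fin r → F) {n₀ : ℕ}
    (hn : ∀ x : ι, (univ.filter fun a : Fin r => c (e a) = x).card ≤ n₀) (ℓ : Sym2 ι)
    (P : Fin r → Prop) [DecidablePred P] {X : ℝ} (hX : 0 ≤ X) :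
    (∑ i : Fin r, ∑ j : Fin r, if P i ∧ s(c (e i), c (e j)) = ℓ then X else 0) ≤
      2 * (n₀ : ℝ) ^ 2 * X := by
  classical
  calc (∑ i : Fin r, ∑ j : Fin r, if P i ∧ s(c (e i), c (e j)) = ℓ then X else 0)
      ≤ ∑ i : Fin r, ∑ j : Fin r, if s(c (e i), c (e j)) = ℓ then X else 0 := by
        refine sum_le_sum fun i _ => sum_le_sum fun j _ => ?_
        split_ifs with h1 h2 h2
        · exact le_rfl
        · exact absurd h1.2 h2
        · exact hX
        · exact le_rfl
    _ = ∑ q : Fin r × Fin r, if s(c (e q.1), c (e q.2)) = ℓ then X else 0 := by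
        rw [← Fintype.sum_prod_type']
    _ = ((univ.filter fun q : Fin r × Fin r => s(c (e q.1), c (e q.2)) = ℓ).card : ℝ) * X := by
        rw [Finset.sum_ite, Finset.sum_const_zero, add_zero, Finset.sum_const, nsmul_eq_mul]
    _ ≤ 2 * (n₀ : ℝ) ^ 2 * X := by
        refine mul_le_mul_of_nonneg_right ?_ hX
        exact_mod_cast card_filter_pairType_le c e n₀ hn ℓ

/-! ### The recursive bound under a determinant bound -/

variable {v : ι} {k : ℕ}

omit [Fintype ι] in
/-- **The interpolated determinants along the line extractions are bounded by the determinant bound,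
uniformly in the interpolation parameters**: if every Gram-weighted minor of `G` (unit real weight
vectors, rows and columns increasing through an increasing enumeration of fields) has `‖det‖ ≤ δ^{size}`
with `δ ≥ 1`, if every cluster carries at most `n` field pairs and `‖G f f'‖ ≤ M_{{c f, c f'}}`, then for
`t ∈ [0,1]^ι` and every stage `(L, I, jm)` of the extraction inside the point set of a valid script,
`‖(assignSum L I jm)(σ_s(t))‖ ≤ δ^{|F_W|} · ∏_{ℓ ∈ L} (2 n² M_ℓ)`. The `t_{ii'} = u_i·u_{i'}` are inner
products of unit vectors (`Script.exists_unit_gram`), so the last determinant — unit rows for the used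
fields, weighted propagators elsewhere — reduces to a weighted minor
(`Matrix.norm_det_le_of_unit_rows_of_minor_bound`).
[cite: BenfattoGiulianiMastropietro2006, (2.66) and (2.80)] -/
theorem norm_eval_aeval_assignSum_le_of_detBound {δ : ℝ} (hδ : 1 ≤ δ)
    (hDB : ∀ (m r : ℕ) (w : Fin r → EuclideanSpace ℝ (Fin m)), (∀ a, ‖w a‖ = 1) →
      ∀ (e : Fin r ↪o F) (c' : ℕ) (ρ γ : Fin c' → Fin r), StrictMono ρ → StrictMono γ →
        ‖(Matrix.of fun a b : Fin c' =>
            ((⟪w (ρ a), w (γ b)⟫_ℝ : ℝ) : 𝕜) * G (e (ρ a)) (e (γ b))).det‖ ≤ δ ^ c')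
    {n₀ : ℕ} (hn : ∀ x : ι, (univ.filter fun f : F => c f = x).card ≤ n₀)
    (M : Sym2 ι → ℝ) (hM0 : ∀ ℓ, 0 ≤ M ℓ) (hGM : ∀ f f', ‖G f f'‖ ≤ M s(c f, c f'))
    (s : Script v k) (hs : s.Valid) {t : ι → ℝ} (ht : t ∈ unitCube ι) :
    ∀ (L : List (Sym2 ι)) (I : Finset F) (jm : F → F)
      (_ : ∀ a ∈ I, c a ∈ univ.image s.y ∧ c (jm a) ∈ univ.image s.y),
      ‖eval (fun i => (t i : 𝕜)) (aeval (s.decPt 𝕜)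
        (assignSum c G (enum c (univ.image s.y)) L I jm))‖ ≤
        δ ^ (fieldsOf c (univ.image s.y)).card * (L.map fun ℓ => 2 * (n₀ : ℝ) ^ 2 * M ℓ).prod
  | [], I, jm, hI => by
    classical
    set Q := univ.image s.y with hQ
    set e := enum c Q with he
    -- the Gram vectors of the interpolation factors
    obtain ⟨u, hu1, hu⟩ := Script.exists_unit_gram s hs t (fun x => (mem_unitCube.1 ht) x)
    -- positions of the clusters of the fields of `Q`
    have hpos : ∀ a : Fin (fieldsOf c Q).card, ∃ p : Fin (k + 1), s.y p = c (e a) := fun a => by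
      obtain ⟨p, -, hp⟩ := mem_image.1 (c_enum_mem c Q a); exact ⟨p, hp⟩
    choose pos hpos using hpos
    -- the column index of the unit rows
    let jidx : Fin (fieldsOf c Q).card → Fin (fieldsOf c Q).card := fun a =>
      if h : jm (e a) ∈ fieldsOf c Q then ((fieldsOf c Q).orderIsoOfFin rfl).symm ⟨jm (e a), h⟩ else a
    have hjidx : ∀ a, e a ∈ I → e (jidx a) = jm (e a) := by
      intro a ha
      have h : jm (e a) ∈ fieldsOf c Q := (mem_fieldsOf c).2 (hI _ ha).2
      have hj : jidx a = ((fieldsOf c Q).orderIsoOfFin rfl).symm ⟨jm (e a), h⟩ := dif_pos h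
      rw [hj]
      show ((fieldsOf c Q).orderEmbOfFin rfl) (((fieldsOf c Q).orderIsoOfFin rfl).symm ⟨jm (e a), h⟩) = jm (e a)
      rw [← Finset.coe_orderIsoOfFin_apply, OrderIso.apply_symm_apply]
    -- the evaluated matrix
    set I' : Finset (Fin (fieldsOf c Q).card) := univ.filter fun a => e a ∈ I with hI'
    set N : Matrix (Fin (fieldsOf c Q).card) (Fin (fieldsOf c Q).card) 𝕜 :=
      ((tmpl c G e I jm).map (aeval (s.decPt 𝕜))).map (eval fun i => (t i : 𝕜)) with hN
    have hdet : eval (fun i => (t i : 𝕜)) (aeval (s.decPt 𝕜) (assignSum c G e [] I jm)) = N.det := by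
      rw [assignSum, AlgHom.map_det, RingHom.map_det, AlgHom.mapMatrix_apply, RingHom.mapMatrix_apply]
    have hentry : ∀ a b, N a b = if a ∈ I' then (if b = jidx a then 1 else 0)
        else ((⟪u (pos a), u (pos b)⟫_ℝ : ℝ) : 𝕜) * G (e a) (e b) := by
      intro a b
      simp only [hN, map_apply, tmpl, hI', mem_filter, mem_univ, true_and]
      by_cases ha : e a ∈ I
      · simp only [if_pos ha]
        by_cases hb : b = jidx a
        · subst hb
          simp [hjidx a ha]
        · have hne : e b ≠ jm (e a) := fun h => hb (e.injective (h.trans (hjidx a ha).symm))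
          simp [hne, hb]
      · simp only [if_neg ha, map_mul, aeval_X, aeval_C, MvPolynomial.algebraMap_eq, eval_C]
        congr 1
        rw [decPt_eq_map, eval_map_algebraMap, ← hpos a, ← hpos b, hu]
    rw [hdet, List.map_nil, List.prod_nil, mul_one]
    -- unit rows for `a ∈ I'`, weighted propagators elsewhere: reduce to the minor
    have hrow : ∀ a ∈ I', ∀ b, N a b = if b = jidx a then 1 else 0 := fun a ha b => by
      rw [hentry, if_pos ha]
    refine Matrix.norm_det_le_of_unit_rows_of_minor_bound N I' jidx hrow (by positivity) ?_
    intro ρ γ hρ hγ hρI hγJ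
    have hsub : N.submatrix ρ γ = Matrix.of fun a b : Fin ((fieldsOf c Q).card - I'.card) =>
        ((⟪(u ∘ pos) (ρ a), (u ∘ pos) (γ b)⟫_ℝ : ℝ) : 𝕜) * G (e (ρ a)) (e (γ b)) := by
      ext a b
      rw [Matrix.submatrix_apply, hentry, if_neg (hρI a)]
      rfl
    rw [hsub]
    calc _ ≤ δ ^ ((fieldsOf c Q).card - I'.card) :=
          hDB (k + 1) _ (u ∘ pos) (fun a => hu1 _) e ((fieldsOf c Q).card - I'.card) ρ γ hρ hγ
      _ ≤ δ ^ (fieldsOf c Q).card := pow_le_pow_right₀ hδ (Nat.sub_le _ _)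
  | ℓ :: L, I, jm, hI => by
    classical
    set Q := univ.image s.y with hQ
    have hn' : ∀ x : ι, (univ.filter fun a : Fin (fieldsOf c Q).card => c (enum c Q a) = x).card ≤ n₀ :=
      card_filter_comp_le_of_injective c (enum c Q).injective hn
    rw [assignSum, map_sum, map_sum]
    refine (norm_sum_le _ _).trans ?_
    have hstep : ∀ i j : Fin (fieldsOf c Q).card,
        ‖eval (fun i => (t i : 𝕜)) (aeval (s.decPt 𝕜)
          (if enum c Q i ∉ I ∧ s(c (enum c Q i), c (enum c Q j)) = ℓ then
            C (G (enum c Q i) (enum c Q j)) *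
              assignSum c G (enum c Q) L (insert (enum c Q i) I)
                (Function.update jm (enum c Q i) (enum c Q j))
          else 0))‖ ≤
        if enum c Q i ∉ I ∧ s(c (enum c Q i), c (enum c Q j)) = ℓ then
          M ℓ * (δ ^ (fieldsOf c Q).card * (L.map fun ℓ => 2 * (n₀ : ℝ) ^ 2 * M ℓ).prod) else 0 := by
      intro i j
      split_ifs with h
      · rw [map_mul, map_mul, aeval_C, MvPolynomial.algebraMap_eq, eval_C, norm_mul]
        refine mul_le_mul ((hGM _ _).trans (by rw [h.2]))
          (norm_eval_aeval_assignSum_le_of_detBound hδ hDB hn M hM0 hGM s hs ht L _ _ fun a ha => ?_)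
          (norm_nonneg _) (hM0 _)
        have hℓ : ∀ x ∈ ℓ, x ∈ Q := by
          intro x hx
          rw [← h.2] at hx
          rcases Sym2.mem_iff.1 hx with rfl | rfl <;> exact c_enum_mem c Q _
        rcases mem_insert.1 ha with rfl | ha
        · rw [Function.update_self]
          exact ⟨hℓ _ (h.2 ▸ Sym2.mem_mk_left _ _), hℓ _ (h.2 ▸ Sym2.mem_mk_right _ _)⟩
        · have hne : a ≠ enum c Q i := fun h' => h.1 (h' ▸ ha)
          rw [Function.update_of_ne hne]
          exact hI a ha
      · rw [map_zero, map_zero, norm_zero]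
    calc ∑ i, ‖eval (fun i => (t i : 𝕜)) (aeval (s.decPt 𝕜) (∑ j,
          if enum c Q i ∉ I ∧ s(c (enum c Q i), c (enum c Q j)) = ℓ then
            C (G (enum c Q i) (enum c Q j)) *
              assignSum c G (enum c Q) L (insert (enum c Q i) I)
                (Function.update jm (enum c Q i) (enum c Q j))
          else 0))‖
        ≤ ∑ i, ∑ j, (if enum c Q i ∉ I ∧ s(c (enum c Q i), c (enum c Q j)) = ℓ then
            M ℓ * (δ ^ (fieldsOf c Q).card * (L.map fun ℓ => 2 * (n₀ : ℝ) ^ 2 * M ℓ).prod) else 0) := by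
          refine sum_le_sum fun i _ => ?_
          rw [map_sum, map_sum]
          exact (norm_sum_le _ _).trans (sum_le_sum fun j _ => hstep i j)
      _ ≤ 2 * (n₀ : ℝ) ^ 2 * (M ℓ * (δ ^ (fieldsOf c Q).card * (L.map fun ℓ => 2 * (n₀ : ℝ) ^ 2 * M ℓ).prod)) := by
          have hX : 0 ≤ M ℓ * (δ ^ (fieldsOf c Q).card * (L.map fun ℓ => 2 * (n₀ : ℝ) ^ 2 * M ℓ).prod) := by
            refine mul_nonneg (hM0 _) (mul_nonneg (by positivity) (List.prod_nonneg fun x hx => ?_))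
            obtain ⟨ℓ', -, rfl⟩ := List.mem_map.1 hx
            exact mul_nonneg (by positivity) (hM0 _)
          exact sum_sum_ite_le_card_mul c (enum c Q) hn' ℓ (fun i => enum c Q i ∉ I) hX
      _ = δ ^ (fieldsOf c Q).card * ((ℓ :: L).map fun ℓ => 2 * (n₀ : ℝ) ^ 2 * M ℓ).prod := by
          rw [List.map_cons, List.prod_cons]
          ring

/-! ### The bound on the truncated expectation -/

/-- **The contribution of one script is bounded by the closed tree bound times its weight**:
`‖scriptTerm s‖ ≤ δ^{|F_W|} ∏_{ℓ ∈ lines s} (2n² M_ℓ) · ∫ w_s`. [folklore] -/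
theorem norm_scriptTerm_le_of_detBound {δ : ℝ} (hδ : 1 ≤ δ)
    (hDB : ∀ (m r : ℕ) (w : Fin r → EuclideanSpace ℝ (Fin m)), (∀ a, ‖w a‖ = 1) →
      ∀ (e : Fin r ↪o F) (c' : ℕ) (ρ γ : Fin c' → Fin r), StrictMono ρ → StrictMono γ →
        ‖(Matrix.of fun a b : Fin c' =>
            ((⟪w (ρ a), w (γ b)⟫_ℝ : ℝ) : 𝕜) * G (e (ρ a)) (e (γ b))).det‖ ≤ δ ^ c')
    {n₀ : ℕ} (hn : ∀ x : ι, (univ.filter fun f : F => c f = x).card ≤ n₀)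
    (M : Sym2 ι → ℝ) (hM0 : ∀ ℓ, 0 ≤ M ℓ) (hGM : ∀ f f', ‖G f f'‖ ≤ M s(c f, c f'))
    (s : Script v k) (hs : s.Valid) :
    ‖scriptTerm c G v s‖ ≤
      δ ^ (fieldsOf c (univ.image s.y)).card * (s.lines.map fun ℓ => 2 * (n₀ : ℝ) ^ 2 * M ℓ).prod *
        cubeIntegral ι ℝ (s.weight ℝ) := by
  rw [scriptTerm, weight_eq_map]
  refine norm_cubeIntegral_map_mul_le _ _ (fun t ht => eval_weight_nonneg s ht) fun t ht => ?_
  exact norm_eval_aeval_assignSum_le_of_detBound c G hδ hDB hn M hM0 hGM s hs ht s.lines ∅ id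
    fun a ha => absurd ha (notMem_empty a)

/-- **The `n!`-free bound on the truncated fermionic expectation under a determinant bound, tree form**
(Benfatto–Giuliani–Mastropietro 2006, (2.66)/(2.77) with the determinant bound (2.80); Mastropietro 2008,
(2.118)–(2.121)): if every Gram-weighted minor of the propagator matrix `G` has `‖det‖ ≤ δ^{size}`
(`δ ≥ 1`), every cluster carries at most `n` field pairs and `‖G f f'‖ ≤ M_{{c f, c f'}}`, then the
truncated expectation of the balanced monomials of the clusters in `W` satisfies
`‖𝓔ᵀ(W)‖ ≤ Σ_{anchored cluster trees T on W} δ^{|F_W|} ∏_{ℓ ∈ T} (2 n² M_ℓ)` (rooted at any `v ∈ W`;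
`|F_W|` the number of field pairs of `W`). No Gram form of `G` and no factorial in the number of fields.
[cite: BenfattoGiulianiMastropietro2006, (2.66) (2.77) (2.80)] -/
theorem norm_ursellOf_moment_le_sum_lineSets_of_detBound {δ : ℝ} (hδ : 1 ≤ δ)
    (hDB : ∀ (m r : ℕ) (w : Fin r → EuclideanSpace ℝ (Fin m)), (∀ a, ‖w a‖ = 1) →
      ∀ (e : Fin r ↪o F) (c' : ℕ) (ρ γ : Fin c' → Fin r), StrictMono ρ → StrictMono γ →
        ‖(Matrix.of fun a b : Fin c' =>
            ((⟪w (ρ a), w (γ b)⟫_ℝ : ℝ) : 𝕜) * G (e (ρ a)) (e (γ b))).det‖ ≤ δ ^ c')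
    {n₀ : ℕ} (hn : ∀ x : ι, (univ.filter fun f : F => c f = x).card ≤ n₀)
    (M : Sym2 ι → ℝ) (hM0 : ∀ ℓ, 0 ≤ M ℓ) (hGM : ∀ f f', ‖G f f'‖ ≤ M s(c f, c f'))
    (W : Finset ι) (hv : v ∈ W) :
    ‖ursellOf (moment c G) W‖ ≤
      ∑ T ∈ lineSets v W, δ ^ (fieldsOf c W).card * ∏ ℓ ∈ T, (2 * (n₀ : ℝ) ^ 2 * M ℓ) := by
  classical
  -- the closed bound of a tree
  set B : Finset (Sym2 ι) → ℝ := fun T => δ ^ (fieldsOf c W).card * ∏ ℓ ∈ T, (2 * (n₀ : ℝ) ^ 2 * M ℓ)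
    with hB
  -- script form
  have h0 : ‖ursellOf (moment c G) W‖ ≤ ∑ k ∈ range (Fintype.card ι), ∑ s : Script v k,
      if s.Valid ∧ univ.image s.y = W then B s.lines.toFinset * cubeIntegral ι ℝ (s.weight ℝ) else 0 := by
    rw [ursellOf_moment_eq_treeSum c G W hv, treeSum]
    refine (norm_sum_le _ _).trans (sum_le_sum fun k _ => (norm_sum_le _ _).trans (sum_le_sum fun s _ => ?_))
    split_ifs with h
    · refine (norm_scriptTerm_le_of_detBound c G hδ hDB hn M hM0 hGM s h.1).trans (le_of_eq ?_)
      rw [hB, ← h.2]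
      simp only
      rw [List.prod_toFinset _ (Script.nodup_lines s h.1)]
    · rw [norm_zero]
  refine h0.trans (le_of_eq ?_)
  -- insert the tree of each script
  have h1 : ∀ (k : ℕ) (hk : k ∈ range (Fintype.card ι)) (s : Script v k),
      (if s.Valid ∧ univ.image s.y = W then B s.lines.toFinset * cubeIntegral ι ℝ (s.weight ℝ) else 0) =
      ∑ T ∈ lineSets v W, if s.Valid ∧ s.lines.toFinset = T then
        B T * cubeIntegral ι ℝ (s.weight ℝ) else 0 := by
    intro k hk s
    by_cases hs : s.Valid
    · simp only [hs, true_and]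
      rw [Finset.sum_ite_eq]
      by_cases hW : univ.image s.y = W
      · have hmem : s.lines.toFinset ∈ lineSets v W :=
          mem_lineSets.2 ⟨k, mem_range.1 hk, s, hs, hW, rfl⟩
        rw [if_pos hW, if_pos hmem]
      · rw [if_neg hW, if_neg]
        intro hmem
        obtain ⟨k', -, s', hs', hW', hT⟩ := mem_lineSets.1 hmem
        exact hW ((Script.image_y_eq_of_lines_eq s s' hT.symm).trans hW')
    · simp only [hs, false_and, if_false]
      exact (sum_const_zero).symm
  rw [sum_congr rfl fun k hk => sum_congr rfl fun s _ => h1 k hk s]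
  -- exchange the sums and use Lemma 2.3
  calc ∑ k ∈ range (Fintype.card ι), ∑ s : Script v k, ∑ T ∈ lineSets v W,
        (if s.Valid ∧ s.lines.toFinset = T then B T * cubeIntegral ι ℝ (s.weight ℝ) else 0)
      = ∑ T ∈ lineSets v W, ∑ k ∈ range (Fintype.card ι), ∑ s : Script v k,
          (if s.Valid ∧ s.lines.toFinset = T then B T * cubeIntegral ι ℝ (s.weight ℝ) else 0) := by
        rw [Finset.sum_comm]; exact sum_congr rfl fun k _ => Finset.sum_comm
    _ = ∑ T ∈ lineSets v W, B T * ∑ k ∈ range (Fintype.card ι), ∑ s : Script v k,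
          (if s.Valid ∧ s.lines.toFinset = T then cubeIntegral ι ℝ (s.weight ℝ) else 0) := by
        refine sum_congr rfl fun T _ => ?_
        rw [Finset.mul_sum]
        refine sum_congr rfl fun k _ => ?_
        rw [Finset.mul_sum]
        refine sum_congr rfl fun s _ => ?_
        rw [mul_ite, mul_zero]
    _ = ∑ T ∈ lineSets v W, B T := by
        refine sum_congr rfl fun T hT => ?_
        obtain ⟨k₀, -, s₀, hs₀, -, rfl⟩ := mem_lineSets.1 hT
        rw [Script.sum_cubeIntegral_weight_eq_one s₀ hs₀, mul_one]

/-- **Cayley form**: with `M*` a common bound for the closed tree bounds,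
`‖𝓔ᵀ(W)‖ ≤ |W|^{|W|-2} · M*`. [cite: Mastropietro2008, Lemma 2.4 (2.121)] -/
theorem norm_ursellOf_moment_le_pow_mul_of_detBound {δ : ℝ} (hδ : 1 ≤ δ)
    (hDB : ∀ (m r : ℕ) (w : Fin r → EuclideanSpace ℝ (Fin m)), (∀ a, ‖w a‖ = 1) →
      ∀ (e : Fin r ↪o F) (c' : ℕ) (ρ γ : Fin c' → Fin r), StrictMono ρ → StrictMono γ →
        ‖(Matrix.of fun a b : Fin c' =>
            ((⟪w (ρ a), w (γ b)⟫_ℝ : ℝ) : 𝕜) * G (e (ρ a)) (e (γ b))).det‖ ≤ δ ^ c')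
    {n₀ : ℕ} (hn : ∀ x : ι, (univ.filter fun f : F => c f = x).card ≤ n₀)
    (M : Sym2 ι → ℝ) (hM0 : ∀ ℓ, 0 ≤ M ℓ) (hGM : ∀ f f', ‖G f f'‖ ≤ M s(c f, c f'))
    (W : Finset ι) (hv : v ∈ W) {Mstar : ℝ} (hM0' : 0 ≤ Mstar)
    (hMstar : ∀ T ∈ lineSets v W, δ ^ (fieldsOf c W).card * ∏ ℓ ∈ T, (2 * (n₀ : ℝ) ^ 2 * M ℓ) ≤ Mstar) :
    ‖ursellOf (moment c G) W‖ ≤ (W.card : ℝ) ^ (W.card - 2) * Mstar := by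
  refine (norm_ursellOf_moment_le_sum_lineSets_of_detBound c G hδ hDB hn M hM0 hGM W hv).trans ?_
  calc ∑ T ∈ lineSets v W, δ ^ (fieldsOf c W).card * ∏ ℓ ∈ T, (2 * (n₀ : ℝ) ^ 2 * M ℓ)
      ≤ ∑ _T ∈ lineSets v W, Mstar := sum_le_sum hMstar
    _ = (lineSets v W).card * Mstar := by rw [sum_const, nsmul_eq_mul]
    _ ≤ (W.card : ℝ) ^ (W.card - 2) * Mstar := by
        refine mul_le_mul_of_nonneg_right ?_ hM0'
        exact_mod_cast card_lineSets_le_pow hv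

end FermionicTree

end Literature.MathematicalPhysics.QuantumLattice
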